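import Literature.MathematicalPhysics.QuantumFieldTheory.Balaban1983to89.B9CubeLettersInvReadDict

/-!
# `Balaban1983to89.B9CubeLettersInvWriteDict` — T. Bałaban, *Propagators for lattice gauge theories in a background field*, Commun. Math. Phys.
# **99** (1985) 389–434 [Balaban1985BackgroundPropagators], (3.42) p. 397 WRITTEN over the gauge-invariant test class from the [4]-(2.51) block
# majorants of the real-coordinate letters (same configuration)

statement-level skeleton of published theorems with citation tags; proofs where landed; nothing here is a claim about the Yang–Mills mass gap

PDF held: `paper:balaban1985-cmp99-background-propagators` (journal page = PDF page + 388); p. 397 read from the held text layer; [4] =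
[Balaban1984PropagatorsII] (2.51) p. 232 («|(Tλ)(x)| ≦ K(y,y′)|λ|»).

THE PRINT.  p. 397, Theorem 3.1 (3.42): *«|(G′(U)λ)(x)|, |(∇_U G′(U)λ)(x)|, |(G′(U)∇*_U λ)(x)|, |(Δ_U G′(U)λ)(x)| ≦ B₀[(Lʲη)², Lʲη, Lʲη, 1]e^{−δ₀d(y,y′)}|λ|
for x ∈ Δ(y), y ∈ Λ_j, supp λ ⊂ Δ(y′)»*; [4] p. 232 (2.51): *«|(Rλ)(x)| ≦ O(M⁻¹)e^{−δ₀d(x,y)}|λ| if supp λ ⊂ Bʲ(y), y ∈ Λ_j.»*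

WHY THIS FILE (cell context: G-B9-LETTERS, the WRITE half of module M5.2's dictionary; consumer M5.1b, which must PRODUCE the block
`B9FromB6.EBlock (kernelFamilySInv i B cfg O par) B₀ δ V` of the cube letters at the configurations of the class (3.37) around `1` — p21's staged root
`hroot` of `B9Cor36GaugeReductionCube.thms31to33_cube_of_reg335` — from the outputs of the Sect.-B machinery, which are block majorants of real-coordinate
letters).  def-Y's `Node00.OpsYRead342.eBlock_kernelFamilyS_of_hasMajorant` writes the (3.42) block of the PRODUCT-class reading from the four majorant
families of the conj-`b` letters `η²O(V)`, `(η⁻¹∇_μ)·(η²O)`, `(η²O)·(−η⁻¹∇*_μ)`, `(η⁻²Δ)·(η²O)`; this file writes the block of the reading over the INVARIANT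
CLASS from the SAME inputs with the SAME constant `M₂(Σ_j‖b_j‖)·B` and rate: the coordinates of ANY `Λ ∈ TestY 𝔸 f` (not only of the products `f ⊗ E`)
are supported in the block of `supp f` and bounded by `M₂|f|` (`norm_apply_le_of_hasMajorant_testY`), so the template's proof goes through with the outer
sup over the class (`iSup_testY_le`).  Together with `B9CubeLettersInvReadDict` §4 the (3.42) block over the class and the four block majorants are
EQUIVALENT up to the basis constant `M₂(Σ_j‖b_j‖)` — «of course with different constants» (p. 403).  Nothing of def-Y's is restated (its letter
composites `gradF_mul_apply ∕ mul_neg_gradB_apply ∕ lap_mul_apply` and bookkeeping are used by name); corner-free members only (section `ιB` of `β`).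

WHAT IS PROVED (all `theorem`s, no `sorry`).  ★ `norm_apply_le_of_hasMajorant_testY`; ★★ `eBlock_kernelFamilySInv_of_hasMajorant`.
-/

noncomputable section

namespace Literature.MathematicalPhysics.QuantumFieldTheory.Balaban1983to89.B9CubeLettersInvWriteDict

open Node00 B9CubeLettersInvReadings B9CubeLettersInvReadDict
open Node00.OpsYRead342 (abs_le_supNorm_inl gradF_mul_apply mul_neg_gradB_apply lap_mul_apply geo9K_len_congr geo9K_dist_congr)
open B6Geom246MultiLevelBox (blkOf)
open B6Ineq2142KLevelV1 (β)
open B6KLevelCensusIndexV1 (KIdx)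
open B6Prop22KLevelCensusEta (epow)
open B6RandomWalk (HasMajorant BlockSupp)
open B9Thm34Ext (toB6)
open B9FromB6 (EBlock)
open B9GeoNormsKLevelV1 (geo9K geo9K_supNorm_nonneg)
open B9Eq352DivFormLetters (coordEquiv conj conj_apply coordEquiv_apply)
open B9Eq352GradLetters (diffLetter diffLetter_inl diffLetter_inr)
open B9Ineq347AllEntries (pref4_nonneg)
open B9Ineq349SiteComposite (supBlkS_le supBlkS'_le etaS_pos)
open B9CoReadingCoords (norm_le_basisBound_mul)
open scoped Matrix

variable {d ℓ : ℕ} {hd : 1 ≤ d + 1} {hL : Odd (ℓ + 1) ∧ 1 < ℓ + 1} {b₀ b₁ : ℝ}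
variable {𝔸 : Type} [NormedRing 𝔸] [NormedAlgebra ℂ 𝔸] [CompleteSpace 𝔸]
variable {ι : Type} [Fintype ι]
variable (i : KIdx d ℓ hd hL b₀ b₁) (b : Module.Basis ι ℝ 𝔸)

section Write

variable {B : B9.Backgrounds} (cfg : B.Cfg → CfgY 𝔸 i) (O : SiteOpY 𝔸 i) (par : SiteParY 𝔸 i) {U₁ : B.Cfg}
variable [Fintype (geo9K i).Site] {Rr : ℝ} {Hp : Prop}

omit [NormedRing 𝔸] [NormedAlgebra ℂ 𝔸] [CompleteSpace 𝔸] [Fintype ι] [Fintype (geo9K i).Site] in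
/-- the (2.67)∕(3.42) length of a carrier index is non-negative. [cite: Balaban1985BackgroundPropagators, (3.41) p.397, bookkeeping] -/
private theorem geo9K_len_nonneg (c : IBondY i) : 0 ≤ (geo9K i).len c := (B6KLevelCensusIndexV1.len_pos i c).le

omit [CompleteSpace 𝔸] in
/-- ★ **THE (2.51) WRITING THROUGH COORDINATES, FOR EVERY TEST FUNCTION OF THE CLASS**: a block majorant `K` of `conj b T` w.r.t. `(z, j) ↦ ιB(Δ(z))`
bounds `‖(TΛ)(z)‖` for every `Λ` with `‖Λ(w)‖ ≤ |f(w)|`, `supp f ⊂ Δ(βy′)`, by `(Σ_j‖b_j‖)·K(ιB(Δ(z)), ιB(βy′))·M₂|f|` (the coordinates of `Λ` are supported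
in the block of `ιB(βy′)` and bounded by `M₂|f|`). [cite: Balaban1984PropagatorsII, (2.51) p.232 («|(Tλ)(x)| ≤ K(y,y′)|λ|»); Balaban1985BackgroundPropagators, (3.39) + (3.42) p.397] -/
theorem norm_apply_le_of_hasMajorant_testY (T : Module.End ℝ (SiteY i → 𝔸)) (ιB : BlkY i → IBondY i)
    {M₂ : ℝ} (hM₂ : 0 ≤ M₂) (hrepr : ∀ (v : 𝔸) (j : ι), |b.repr v j| ≤ M₂ * ‖v‖) {Kmaj : IBondY i → IBondY i → ℝ}
    (h : HasMajorant (g := toB6 (geo9K i) Rr Hp) (fun p : SiteY i × ι => ιB (blkOf i.D.toDomains p.1)) (conj b T) Kmaj)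
    (f : SiteY i → ℝ) (y' : IBondY i) (hs : (geo9K i).suppIn (Sum.inl f) y') (Λ : TestY 𝔸 f) (z : SiteY i) :
    ‖T Λ.1 z‖ ≤ (∑ j, ‖b j‖) * (Kmaj (ιB (blkOf i.D.toDomains z)) (ιB (β i.hN i.D i.hk y')) * (M₂ * (geo9K i).supNorm (Sum.inl f))) := by
  have hN0 : 0 ≤ (geo9K i).supNorm (Sum.inl f) := geo9K_supNorm_nonneg i _
  have hBS : BlockSupp (g := toB6 (geo9K i) Rr Hp) (fun p : SiteY i × ι => ιB (blkOf i.D.toDomains p.1)) (coordEquiv b Λ.1)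
      (ιB (β i.hN i.D i.hk y')) (M₂ * (geo9K i).supNorm (Sum.inl f)) := by
    refine ⟨mul_nonneg hM₂ hN0, fun p _ => ?_, fun p hp => ?_⟩
    · rw [coordEquiv_apply]
      calc |b.repr (Λ.1 p.1) p.2| ≤ M₂ * ‖Λ.1 p.1‖ := hrepr _ _
        _ ≤ M₂ * (geo9K i).supNorm (Sum.inl f) :=
            mul_le_mul_of_nonneg_left ((Λ.2 p.1).trans (abs_le_supNorm_inl i f p.1)) hM₂
    · have hf : f p.1 = 0 := by
        by_contra hf
        exact hp (congrArg ιB (hs p.1 hf))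
      have hΛ : Λ.1 p.1 = 0 := by
        have h0 : ‖Λ.1 p.1‖ ≤ 0 := by simpa only [hf, abs_zero] using Λ.2 p.1
        exact norm_le_zero_iff.1 h0
      rw [coordEquiv_apply, hΛ, map_zero, Finsupp.zero_apply]
  have hco : ∀ j : ι, |b.repr (T Λ.1 z) j| ≤
      Kmaj (ιB (blkOf i.D.toDomains z)) (ιB (β i.hN i.D i.hk y')) * (M₂ * (geo9K i).supNorm (Sum.inl f)) := by
    intro j
    have h1 := h _ _ _ hBS (z, j)
    simpa only [conj_apply, LinearEquiv.symm_apply_apply] using h1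
  exact norm_le_basisBound_mul b _ hco

/-- ★★ **WRITE AT ONE CONFIGURATION, OVER THE CLASS**: block majorants `B·ℓ(a)^{(2,1,1,0)}·e^{−δd(a,a′)}` of the four conjugated letters at `cfg U₁` —
`conj b (η²O)`, `conj b (η⁻¹∇_μ-letter) * conj b (η²O)` (every `μ`), `conj b (η²O) * conj b (−η⁻¹∇*_μ-letter)` (every `μ`), `conj b (η⁻²Δ) * conj b (η²O)` —
give the (3.42) block of the reading `kernelFamilySInv i B cfg O par` OVER THE INVARIANT CLASS at `U₁` with constant `M₂(Σ_j‖b_j‖)·B` and the SAME rate `δ`.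
[cite: Balaban1985BackgroundPropagators, (3.42) p.397, (3.39) p.397 (sup over all λ); Balaban1984PropagatorsII, (2.51)–(2.52) p.232] -/
theorem eBlock_kernelFamilySInv_of_hasMajorant (ιB : BlkY i → IBondY i) (hι : ∀ s, β i.hN i.D i.hk (ιB s) = s)
    {M₂ : ℝ} (hM₂ : 0 ≤ M₂) (hrepr : ∀ (v : 𝔸) (j : ι), |b.repr v j| ≤ M₂ * ‖v‖) {η : ℝ} (hη : η = etaS i)
    {Uc : Fin (d + 1) → SiteY i → 𝔸ˣ} (hUc : Uc = UboxY i (cfg U₁))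
    (G L : Module.End ℝ (SiteY i → 𝔸)) (hG : ∀ Λ, G Λ = (η ^ 2) • O (cfg U₁) Λ) (hL : ∀ Λ, L Λ = (η ^ 2)⁻¹ • lapS i (cfg U₁) Λ)
    {Bc δ : ℝ} (hBc : 0 ≤ Bc)
    (h0 : HasMajorant (g := toB6 (geo9K i) Rr Hp) (fun p : SiteY i × ι => ιB (blkOf i.D.toDomains p.1)) (conj b G)
      (fun a a' => Bc * (geo9K i).len a ^ 2 * Real.exp (-(δ * (geo9K i).dist a a'))))
    (h1 : ∀ μ : Fin (d + 1), HasMajorant (g := toB6 (geo9K i) Rr Hp) (fun p : SiteY i × ι => ιB (blkOf i.D.toDomains p.1))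
      (conj b (diffLetter (shiftY i) Uc (((η : ℂ))⁻¹) (Sum.inl μ)) * conj b G)
      (fun a a' => Bc * (geo9K i).len a * Real.exp (-(δ * (geo9K i).dist a a'))))
    (h2 : ∀ μ : Fin (d + 1), HasMajorant (g := toB6 (geo9K i) Rr Hp) (fun p : SiteY i × ι => ιB (blkOf i.D.toDomains p.1))
      (conj b G * conj b (diffLetter (shiftY i) Uc (((η : ℂ))⁻¹) (Sum.inr μ)))
      (fun a a' => Bc * (geo9K i).len a * Real.exp (-(δ * (geo9K i).dist a a'))))
    (h3 : HasMajorant (g := toB6 (geo9K i) Rr Hp) (fun p : SiteY i × ι => ιB (blkOf i.D.toDomains p.1)) (conj b L * conj b G)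
      (fun a a' => Bc * 1 * Real.exp (-(δ * (geo9K i).dist a a')))) :
    EBlock (kernelFamilySInv i B cfg O par) (M₂ * (∑ j, ‖b j‖) * Bc) δ U₁ := by
  subst hη hUc
  have hSb : 0 ≤ ∑ j, ‖b j‖ := Finset.sum_nonneg fun _ _ => norm_nonneg _
  have hC : 0 ≤ M₂ * (∑ j, ‖b j‖) * Bc := mul_nonneg (mul_nonneg hM₂ hSb) hBc
  intro n lam y y' hs
  have hRHS : 0 ≤ M₂ * (∑ j, ‖b j‖) * Bc * B9.pref4 ((geo9K i).len y) n * Real.exp (-(δ * (geo9K i).dist y y')) * (geo9K i).supNorm lam :=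
    mul_nonneg (mul_nonneg (mul_nonneg hC (pref4_nonneg _ (geo9K_len_nonneg i y) n)) (Real.exp_pos _).le) (geo9K_supNorm_nonneg i lam)
  cases lam with
  | inr J => exact hRHS
  | inl f =>
    have hR : ∀ {P : ℝ}, 0 ≤ P →
        0 ≤ M₂ * (∑ j, ‖b j‖) * Bc * P * Real.exp (-(δ * (geo9K i).dist y y')) * (geo9K i).supNorm (Sum.inl f) := fun hP =>
      mul_nonneg (mul_nonneg (mul_nonneg hC hP) (Real.exp_pos _).le) (geo9K_supNorm_nonneg i _)
    have hlen : ∀ z : SiteY i, blkOf i.D.toDomains z = β i.hN i.D i.hk y → (geo9K i).len (ιB (blkOf i.D.toDomains z)) = (geo9K i).len y :=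
      fun z hz => geo9K_len_congr i (by rw [hι]; exact hz)
    have hdist : ∀ z : SiteY i, blkOf i.D.toDomains z = β i.hN i.D i.hk y →
        (geo9K i).dist (ιB (blkOf i.D.toDomains z)) (ιB (β i.hN i.D i.hk y')) = (geo9K i).dist y y' :=
      fun z hz => geo9K_dist_congr i (by rw [hι]; exact hz) (hι _)
    fin_cases n
    · -- (3.42)₁: η²·sup_Λ sup_{z ∈ Δ(y)} ‖(OΛ)(z)‖
      show etaS i ^ (epow 0) * (⨆ Λ : TestY 𝔸 f, eLatS i O (cfg U₁) Λ.1 (β i.hN i.D i.hk y) 0) ≤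
        M₂ * (∑ j, ‖b j‖) * Bc * ((geo9K i).len y ^ 2) * Real.exp (-(δ * (geo9K i).dist y y')) * (geo9K i).supNorm (Sum.inl f)
      have h0e : epow 0 = 2 := rfl
      have hη : 0 < etaS i ^ 2 := pow_pos (etaS_pos i) 2
      rw [h0e, mul_comm, ← le_div_iff₀ hη]
      refine iSup_testY_le (fun Λ => ?_) (div_nonneg (hR (sq_nonneg _)) hη.le)
      show supBlkS i (β i.hN i.D i.hk y) (O (cfg U₁) Λ.1) ≤ _
      refine supBlkS_le i _ _ (div_nonneg (hR (sq_nonneg _)) hη.le) fun z hz => ?_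
      rw [le_div_iff₀ hη, mul_comm]
      have hw := norm_apply_le_of_hasMajorant_testY i b (Rr := Rr) (Hp := Hp) G ιB hM₂ hrepr h0 f y' hs Λ z
      rw [hG, Pi.smul_apply, norm_smul, Real.norm_eq_abs, abs_of_nonneg (sq_nonneg _), hlen z hz, hdist z hz] at hw
      exact hw.trans (le_of_eq (by ring))
    · -- (3.42)₂: η·sup ‖(∇_{V,μ}OΛ)(z)‖
      show etaS i ^ (epow 1) * (⨆ Λ : TestY 𝔸 f, eLatS i O (cfg U₁) Λ.1 (β i.hN i.D i.hk y) 1) ≤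
        M₂ * (∑ j, ‖b j‖) * Bc * (geo9K i).len y * Real.exp (-(δ * (geo9K i).dist y y')) * (geo9K i).supNorm (Sum.inl f)
      have h1e : epow 1 = 1 := rfl
      have hη : 0 < etaS i := etaS_pos i
      rw [h1e, pow_one, mul_comm, ← le_div_iff₀ hη]
      refine iSup_testY_le (fun Λ => ?_) (div_nonneg (hR (geo9K_len_nonneg i y)) hη.le)
      show supBlkS' i (β i.hN i.D i.hk y) (fun ν => cdS i (cfg U₁) ν (O (cfg U₁) Λ.1)) ≤ _
      refine supBlkS'_le i _ _ (div_nonneg (hR (geo9K_len_nonneg i y)) hη.le) fun z ν hz => ?_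
      rw [le_div_iff₀ hη, mul_comm]
      have h1' := h1 ν
      rw [diffLetter_inl, ← B9Eq352DivFormLetters.conj_mul] at h1'
      have hw := norm_apply_le_of_hasMajorant_testY i b (Rr := Rr) (Hp := Hp) _ ιB hM₂ hrepr h1' f y' hs Λ z
      rw [gradF_mul_apply i O (cfg U₁) G hG, norm_smul, Complex.norm_real, Real.norm_eq_abs, abs_of_nonneg hη.le, hlen z hz, hdist z hz] at hw
      exact hw.trans (le_of_eq (by ring))
    · -- (3.42)₃: η·sup ‖(O∇*_{V,μ}Λ)(z)‖
      show etaS i ^ (epow 2) * (⨆ Λ : TestY 𝔸 f, eLatS i O (cfg U₁) Λ.1 (β i.hN i.D i.hk y) 2) ≤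
        M₂ * (∑ j, ‖b j‖) * Bc * (geo9K i).len y * Real.exp (-(δ * (geo9K i).dist y y')) * (geo9K i).supNorm (Sum.inl f)
      have h2e : epow 2 = 1 := rfl
      have hη : 0 < etaS i := etaS_pos i
      rw [h2e, pow_one, mul_comm, ← le_div_iff₀ hη]
      refine iSup_testY_le (fun Λ => ?_) (div_nonneg (hR (geo9K_len_nonneg i y)) hη.le)
      show supBlkS' i (β i.hN i.D i.hk y) (fun ν => O (cfg U₁) (cdsS i (cfg U₁) ν Λ.1)) ≤ _
      refine supBlkS'_le i _ _ (div_nonneg (hR (geo9K_len_nonneg i y)) hη.le) fun z ν hz => ?_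
      rw [le_div_iff₀ hη, mul_comm]
      have h2' := h2 ν
      rw [diffLetter_inr, ← B9Eq352DivFormLetters.conj_mul] at h2'
      have hw := norm_apply_le_of_hasMajorant_testY i b (Rr := Rr) (Hp := Hp) _ ιB hM₂ hrepr h2' f y' hs Λ z
      rw [mul_neg_gradB_apply i O (cfg U₁) G hG, norm_neg, norm_smul, Complex.norm_real, Real.norm_eq_abs, abs_of_nonneg hη.le, hlen z hz,
        hdist z hz] at hw
      exact hw.trans (le_of_eq (by ring))
    · -- (3.42)₄: sup ‖(Δ_V OΛ)(z)‖
      show etaS i ^ (epow 3) * (⨆ Λ : TestY 𝔸 f, eLatS i O (cfg U₁) Λ.1 (β i.hN i.D i.hk y) 3) ≤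
        M₂ * (∑ j, ‖b j‖) * Bc * 1 * Real.exp (-(δ * (geo9K i).dist y y')) * (geo9K i).supNorm (Sum.inl f)
      have h3e : epow 3 = 0 := rfl
      rw [h3e, pow_zero, one_mul]
      refine iSup_testY_le (fun Λ => ?_) (hR zero_le_one)
      show supBlkS i (β i.hN i.D i.hk y) (lapS i (cfg U₁) (O (cfg U₁) Λ.1)) ≤ _
      refine supBlkS_le i _ _ (hR zero_le_one) fun z hz => ?_
      have h3' := h3
      rw [← B9Eq352DivFormLetters.conj_mul] at h3'
      have hw := norm_apply_le_of_hasMajorant_testY i b (Rr := Rr) (Hp := Hp) _ ιB hM₂ hrepr h3' f y' hs Λ z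
      rw [lap_mul_apply i O (cfg U₁) G L hG hL, hdist z hz] at hw
      exact hw.trans (le_of_eq (by ring))

end Write

end Literature.MathematicalPhysics.QuantumFieldTheory.Balaban1983to89.B9CubeLettersInvWriteDict

end
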